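import Literature.NumberTheory.Sieve.CubicMinorantDefs
import Literature.NumberTheory.Sieve.CubicFormClassBrunTitchmarsh
import HarnessLib

/-!
# Residue-class sums of the Heath-Brown weight: a Brun–Titchmarsh bound, PROVED

Topic `Literature/NumberTheory/Sieve`, namespace `Literature.NumberTheory.Sieve.CubicMinorant`;
companion of `CubicMinorantDefs.lean` (the weight `f₃(k) = N^{1/3} (log k) · #{(x, y) ∈ primePairs X η :
x³ + 2y³ = k}`, `X = (N/6)^{1/3}`, `η = (log X)^{−c}`) and of `CubicFormClassBrunTitchmarsh.lean` (the
β-sieve / Brun–Titchmarsh bound `card_classBoxPairs_prime_le` for the prime values of `x³ + 2y³` on the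
pairs of a residue class `(x, y) ≡ (a, b) (mod d)` of a box).  We PROVE the bridge the dispersion
argument for `n = p + (x³ + 2y³)` needs (parity-ideate route `GoldbachHeathBrownDispersion`, crux
ModelDispersion, input «ClassBrunTitchmarshHB»):

* **`sum_hbWeight_modEq_le`** — there are absolute `C, L₀` with
  `∑_{k ≤ N, k ≡ r (mod d)} f₃(k) ≤ C · N^{1/3} log N · ν_d(r) · cw(d) · (L/d)² / log(L/d)`
  for every `c`, `N`, every modulus `d ≥ 1` and every `r` coprime to `d`, as soon as `L/d ≥ L₀`; here
  `L = ⌊X(1+η)⌋ − ⌊X⌋` is the integer side of Heath-Brown's box, `ν_d(r) = #{(a, b) mod d :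
  a³ + 2b³ ≡ r}` (`cubicClassCount`), `cw(d) = coprimeClassWeight d = ∏_{p∣d}(1 − ν_p/(p+1))⁻¹`.
  (So `≪_θ η² N (log N/log(ηX/d)) ν_d(r) cw(d)/d²`, i.e. `≪ η²N ν_d(r) cw(d)/d²` for `d ≤ (ηX)^{1−θ}`.)
* **`sum_hbWeight_modEq_eq_zero_of_not_coprime`** — for `r` NOT coprime to `d` and `d ≤ N/6` the class
  sum vanishes (a value `x³ + 2y³ > X³ = N/6 ≥ d` that is prime cannot share a factor with `d`).
* `hbBox_eq`, `Ioc_floor_eq_Ioc_add_hbSide`, `primePairs_subset_box` — the route's box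
  `{X < x, y ≤ X(1+η)}` is the integer box `(⌊X⌋, ⌊X⌋ + L]²`, which carries Heath-Brown's prime pairs.
* `cubicClassCount_eq_of_coprime` — for `(r, d) = 1`, `ν_d(r)` is the numerator
  `#{(a,b) mod d : a³+2b³ ≡ r, (a³+2b³, d) = 1}` of the route's local density `locDensity(d, r)`.

Method: `log k ≤ log N` on `k ≤ N`; `∑_{k ≡ r} #{pairs with value k} = #{prime pairs with value ≡ r}`
(fibres); Heath-Brown's pairs lie in the integer box `(⌊X⌋, ⌊X(1+η)⌋]²`; split the box over the `d²`
classes of pairs `(a, b) (mod d)` — only the `ν_d(r)` classes with `a³ + 2b³ ≡ r` contribute, each at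
most `C cw(d) (L/d)²/log(L/d)` by `card_classBoxPairs_prime_le` (the class is admissible because
`(r, d) = 1`). [HeathBrownMoroz2004, §3 (3.1)–(3.3); HalberstamRichert1974, Thm 2.2 / Thm 3.6 (Brun–Titchmarsh shape)]

## References

* [HeathBrownMoroz2004] D. R. Heath-Brown, B. Z. Moroz, *On primes represented by cubic polynomials*,
  Proc. LMS (3) 88 (2004), §3 (3.1)–(3.3) (prime values of the form in residue classes of pairs).
* [HeathBrownActa2001] D. R. Heath-Brown, *Primes represented by x³ + 2y³*, Acta Math. 186 (2001),
  Theorem 1 / §2 (2.2) (the box `X < x, y ≤ X(1+η)` and its prime pairs).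
* [HalberstamRichert1974] H. Halberstam, H.-E. Richert, *Sieve Methods*, Thm 2.2, Thm 3.6.

## Mathlib / tree search

Tree: `CubicPrimes.primePairs`, `mem_primePairs_iff`, `hbWeight`, `hbRep`, `hbX`, `hbEta`
(`CubicMinorantDefs`, `HeathBrownCubicPrimes`); `classBoxPairs`, `coprimeClassWeight`,
`card_classBoxPairs_prime_le`, `mem_classBoxPairs_iff`, `card_filter_box_eq_sum_classBoxPairs`,
`value_modEq_of_mem_classBoxPairs` (`CubicFormClassBrunTitchmarsh`).
Mathlib: `Finset.sum_card_fiberwise_eq_card_filter`, `Finset.card_eq_sum_card_fiberwise`,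
`Nat.ModEq.gcd_eq`, `Nat.floor_lt`, `Nat.le_floor`.
`lean search 'cubicClassCount|sum_hbWeight_modEq'`: nothing before this file.
-/

noncomputable section

open Finset

namespace Literature.NumberTheory.Sieve.CubicMinorant

open Literature.NumberTheory.Sieve.CubicPrimes

/-! ### The class count `ν_d(r)` -/

/-- `ν_d(r) = #{(a, b) mod d : a³ + 2b³ ≡ r (mod d)}`. [cite: HeathBrownMoroz2004, §3 (3.1)] -/
def cubicClassCount (d r : ℕ) : ℕ :=
  #{ab ∈ range d ×ˢ range d | ab.1 ^ 3 + 2 * ab.2 ^ 3 ≡ r [MOD d]}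

/-- `cubicClassCount` unfolded. [cite: HeathBrownMoroz2004, §3 (3.1)] -/
theorem cubicClassCount_def (d r : ℕ) :
    cubicClassCount d r = #{ab ∈ range d ×ˢ range d | ab.1 ^ 3 + 2 * ab.2 ^ 3 ≡ r [MOD d]} := rfl

/-- `ν_d(r) ≤ d²`. [cite: HeathBrownMoroz2004, §3 (3.1)] -/
theorem cubicClassCount_le (d r : ℕ) : cubicClassCount d r ≤ d ^ 2 := by
  rw [cubicClassCount]
  calc #{ab ∈ range d ×ˢ range d | ab.1 ^ 3 + 2 * ab.2 ^ 3 ≡ r [MOD d]} ≤ #(range d ×ˢ range d) :=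
        card_filter_le _ _
    _ = d ^ 2 := by rw [card_product, card_range, sq]

/-- For `(r, d) = 1` the coprimality conjunct of the route's local density numerator is automatic:
`ν_d(r) = #{(a, b) mod d : a³ + 2b³ ≡ r, (a³ + 2b³, d) = 1}`. [cite: HeathBrownMoroz2004, §3 (3.1)] -/
theorem cubicClassCount_eq_of_coprime {d r : ℕ} (hr : Nat.Coprime r d) :
    cubicClassCount d r =
      #{ab ∈ range d ×ˢ range d |
        ab.1 ^ 3 + 2 * ab.2 ^ 3 ≡ r [MOD d] ∧ Nat.Coprime (ab.1 ^ 3 + 2 * ab.2 ^ 3) d} := by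
  rw [cubicClassCount]
  congr 1
  refine filter_congr fun ab _ => ?_
  constructor
  · intro h
    refine ⟨h, ?_⟩
    rw [Nat.Coprime, h.gcd_eq]
    exact hr
  · exact fun h => h.1

/-! ### Heath-Brown's pairs sit in the integer box `(⌊X⌋, ⌊X(1+η)⌋]²` -/

/-- `X = (N/6)^{1/3} ≥ 0` (private copy of `hbX_nonneg`). [folklore] -/
private theorem hbX_nonneg' (N : ℕ) : 0 ≤ hbX N := Real.rpow_nonneg (by positivity) _

/-- `X³ = N/6` (private copy of `hbX_pow_three`). [folklore] -/
private theorem hbX_pow_three' (N : ℕ) : hbX N ^ 3 = (N : ℝ) / 6 := by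
  unfold hbX
  rw [← Real.rpow_natCast, ← Real.rpow_mul (by positivity)]
  norm_num

/-- The integer side of Heath-Brown's box: `L = ⌊X(1+η)⌋ − ⌊X⌋`.
[cite: HeathBrownActa2001, Theorem 1 (the box X < x, y ≤ X(1+η))] -/
def hbSide (c : ℝ) (N : ℕ) : ℕ := ⌊hbX N * (1 + hbEta c N)⌋₊ - ⌊hbX N⌋₊

/-- `hbSide` unfolded. [cite: HeathBrownActa2001, Theorem 1 (the box X < x, y ≤ X(1+η))] -/
theorem hbSide_def (c : ℝ) (N : ℕ) : hbSide c N = ⌊hbX N * (1 + hbEta c N)⌋₊ - ⌊hbX N⌋₊ := rfl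

/-- **Heath-Brown's prime pairs lie in the integer box** `(⌊X⌋, ⌊X⌋ + L]²` once `L ≥ 1`
(i.e. `⌊X⌋ < ⌊X(1+η)⌋`). [cite: HeathBrownActa2001, §2 (2.2)] -/
theorem primePairs_subset_box (c : ℝ) (N : ℕ) (hL : 1 ≤ hbSide c N) :
    primePairs (hbX N) (hbEta c N) ⊆
      Ioc ⌊hbX N⌋₊ (⌊hbX N⌋₊ + hbSide c N) ×ˢ Ioc ⌊hbX N⌋₊ (⌊hbX N⌋₊ + hbSide c N) := by
  have hAM : ⌊hbX N⌋₊ ≤ ⌊hbX N * (1 + hbEta c N)⌋₊ := by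
    have : 0 < ⌊hbX N * (1 + hbEta c N)⌋₊ - ⌊hbX N⌋₊ := by rw [← hbSide_def]; omega
    omega
  have htop : ⌊hbX N⌋₊ + hbSide c N = ⌊hbX N * (1 + hbEta c N)⌋₊ := by
    rw [hbSide_def]; omega
  rw [htop]
  rintro ⟨x, y⟩ hxy
  obtain ⟨hx1, hx2, hy1, hy2, -, -⟩ := mem_primePairs_iff.mp hxy
  have hX := hbX_nonneg' N
  rw [mem_product, mem_Ioc, mem_Ioc]
  exact ⟨⟨(Nat.floor_lt hX).mpr hx1, Nat.le_floor hx2⟩, (Nat.floor_lt hX).mpr hy1, Nat.le_floor hy2⟩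

/-- **The route's real-inequality box is the integer box** `(⌊X⌋, ⌊X(1+η)⌋]²` (the form in which
the parity-ideate route `GoldbachHeathBrownDispersion` writes Heath-Brown's box).
[cite: HeathBrownActa2001, Theorem 1 (the box X < x, y ≤ X(1+η))] -/
theorem hbBox_eq (c : ℝ) (N : ℕ) :
    (Iic ⌊hbX N * (1 + hbEta c N)⌋₊ ×ˢ Iic ⌊hbX N * (1 + hbEta c N)⌋₊).filter
        (fun xy : ℕ × ℕ => hbX N < xy.1 ∧ (xy.1 : ℝ) ≤ hbX N * (1 + hbEta c N) ∧
          hbX N < xy.2 ∧ (xy.2 : ℝ) ≤ hbX N * (1 + hbEta c N)) =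
      Ioc ⌊hbX N⌋₊ ⌊hbX N * (1 + hbEta c N)⌋₊ ×ˢ Ioc ⌊hbX N⌋₊ ⌊hbX N * (1 + hbEta c N)⌋₊ := by
  have hX := hbX_nonneg' N
  ext ⟨x, y⟩
  simp only [mem_filter, mem_product, mem_Iic, mem_Ioc]
  by_cases hY : 0 ≤ hbX N * (1 + hbEta c N)
  · rw [← Nat.floor_lt hX, ← Nat.floor_lt hX, ← Nat.le_floor_iff hY, ← Nat.le_floor_iff hY]
    tauto
  · push Not at hY
    have h0 : ⌊hbX N * (1 + hbEta c N)⌋₊ = 0 := Nat.floor_of_nonpos hY.le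
    rw [h0]
    constructor
    · rintro ⟨-, -, hx, -⟩
      have : (0 : ℝ) ≤ x := Nat.cast_nonneg x
      linarith
    · rintro ⟨⟨hx1, hx2⟩, -⟩
      omega

/-- `(A, M] = (A, A + (M − A)]` (both empty if `M < A`): the integer box has side `hbSide`.
[cite: HeathBrownActa2001, Theorem 1 (the box X < x, y ≤ X(1+η))] -/
theorem Ioc_floor_eq_Ioc_add_hbSide (c : ℝ) (N : ℕ) :
    Ioc ⌊hbX N⌋₊ ⌊hbX N * (1 + hbEta c N)⌋₊ = Ioc ⌊hbX N⌋₊ (⌊hbX N⌋₊ + hbSide c N) := by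
  rw [hbSide_def]
  rcases le_or_gt ⌊hbX N⌋₊ ⌊hbX N * (1 + hbEta c N)⌋₊ with h | h
  · rw [Nat.add_sub_cancel' h]
  · rw [Nat.sub_eq_zero_of_le h.le, add_zero, Finset.Ioc_self, Finset.Ioc_eq_empty (not_lt.mpr h.le)]

/-! ### The class sums of the weight -/

/-- **Class sums of `f₃` are prime-pair counts**: `∑_{k ≤ N, k ≡ r (d)} f₃(k) ≤ N^{1/3} log N ·
#{(x, y) ∈ primePairs : x³ + 2y³ ≡ r (mod d)}`. [cite: HeathBrownMoroz2004, §3 (3.1)] -/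
theorem sum_hbWeight_modEq_le_card (c : ℝ) (N d r : ℕ) :
    ∑ k ∈ (Icc 1 N).filter (fun k : ℕ => k ≡ r [MOD d]), hbWeight c N k ≤
      (N : ℝ) ^ ((1 : ℝ) / 3) * Real.log N *
        #{xy ∈ primePairs (hbX N) (hbEta c N) | xy.1 ^ 3 + 2 * xy.2 ^ 3 ≡ r [MOD d]} := by
  set T := (Icc 1 N).filter (fun k : ℕ => k ≡ r [MOD d]) with hT
  have hN0 : (0 : ℝ) ≤ (N : ℝ) ^ ((1 : ℝ) / 3) := by positivity
  have step1 : ∑ k ∈ T, hbWeight c N k ≤ ∑ k ∈ T, (N : ℝ) ^ ((1 : ℝ) / 3) * Real.log N * (hbRep c N k : ℝ) := by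
    refine sum_le_sum fun k hk => ?_
    rw [hT, mem_filter, mem_Icc] at hk
    have hk1 : (1 : ℝ) ≤ k := by exact_mod_cast hk.1.1
    have hkN : (k : ℝ) ≤ N := by exact_mod_cast hk.1.2
    have hlog : Real.log k ≤ Real.log N := Real.log_le_log (by linarith) hkN
    have hlog0 : 0 ≤ Real.log k := Real.log_nonneg hk1
    unfold hbWeight
    exact mul_le_mul_of_nonneg_right (mul_le_mul_of_nonneg_left hlog hN0) (Nat.cast_nonneg _)
  refine step1.trans ?_
  rw [← mul_sum]
  refine mul_le_mul_of_nonneg_left ?_ (mul_nonneg hN0 (Real.log_natCast_nonneg N))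
  have hfib : ∑ k ∈ T, (hbRep c N k : ℝ) =
      #{xy ∈ primePairs (hbX N) (hbEta c N) | xy.1 ^ 3 + 2 * xy.2 ^ 3 ∈ T} := by
    rw [← Nat.cast_sum, Nat.cast_inj]
    exact sum_card_fiberwise_eq_card_filter _ _ _
  rw [hfib]
  exact_mod_cast card_le_card (fun xy hxy => by
    rw [mem_filter] at hxy ⊢
    exact ⟨hxy.1, (mem_filter.mp hxy.2).2⟩)

/-- **Prime values `≡ r (mod d)` on a box of pairs, via the classes of pairs**: for `(r, d) = 1` and
`L/d ≥ L₀`, `#{(x,y) ∈ (A, A+L]² : x³+2y³ prime, ≡ r (mod d)} ≤ ν_d(r) · C cw(d) (L/d)²/log(L/d)`.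
[cite: HeathBrownMoroz2004, §3 (3.1)–(3.3)] -/
theorem card_box_prime_modEq_le :
    ∃ C L₀ : ℝ, 0 < C ∧ ∀ (A L d r : ℕ), 0 < d → Nat.Coprime r d → L₀ ≤ (L : ℝ) / d →
      (#{xy ∈ Ioc A (A + L) ×ˢ Ioc A (A + L) |
          (xy.1 ^ 3 + 2 * xy.2 ^ 3).Prime ∧ xy.1 ^ 3 + 2 * xy.2 ^ 3 ≡ r [MOD d]} : ℝ) ≤
        cubicClassCount d r * (C * coprimeClassWeight d * ((L : ℝ) / d) ^ 2 / Real.log ((L : ℝ) / d)) := by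
  obtain ⟨C, L₀, hC, hBT⟩ := card_classBoxPairs_prime_le
  refine ⟨C, L₀, hC, fun A L d r hd hr hL => ?_⟩
  rw [card_filter_box_eq_sum_classBoxPairs hd A A L, Nat.cast_sum]
  -- classes with `a³ + 2b³ ≢ r` contribute nothing
  have hvanish : ∀ ab ∈ range d ×ˢ range d,
      (#{xy ∈ classBoxPairs A A L d ab.1 ab.2 |
          (xy.1 ^ 3 + 2 * xy.2 ^ 3).Prime ∧ xy.1 ^ 3 + 2 * xy.2 ^ 3 ≡ r [MOD d]} : ℝ) ≠ 0 →
        ab.1 ^ 3 + 2 * ab.2 ^ 3 ≡ r [MOD d] := by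
    intro ab _ hne
    by_contra hab
    refine hne ?_
    rw [Nat.cast_eq_zero, card_eq_zero, filter_eq_empty_iff]
    intro xy hxy h
    exact hab ((value_modEq_of_mem_classBoxPairs hxy).symm.trans h.2)
  rw [← sum_filter_of_ne hvanish]
  -- the admissible classes with `a³ + 2b³ ≡ r` contribute `≤ C cw (L/d)²/log(L/d)` each
  have hgood : ∀ ab ∈ (range d ×ˢ range d).filter (fun ab : ℕ × ℕ => ab.1 ^ 3 + 2 * ab.2 ^ 3 ≡ r [MOD d]),
      (#{xy ∈ classBoxPairs A A L d ab.1 ab.2 |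
          (xy.1 ^ 3 + 2 * xy.2 ^ 3).Prime ∧ xy.1 ^ 3 + 2 * xy.2 ^ 3 ≡ r [MOD d]} : ℝ) ≤
        C * coprimeClassWeight d * ((L : ℝ) / d) ^ 2 / Real.log ((L : ℝ) / d) := by
    intro ab hab
    rw [mem_filter] at hab
    have hcop : Nat.Coprime (ab.1 ^ 3 + 2 * ab.2 ^ 3) d := by
      rw [Nat.Coprime, hab.2.gcd_eq]; exact hr
    have h1 : #{xy ∈ classBoxPairs A A L d ab.1 ab.2 |
          (xy.1 ^ 3 + 2 * xy.2 ^ 3).Prime ∧ xy.1 ^ 3 + 2 * xy.2 ^ 3 ≡ r [MOD d]} ≤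
        #{xy ∈ classBoxPairs A A L d ab.1 ab.2 | (xy.1 ^ 3 + 2 * xy.2 ^ 3).Prime} :=
      card_le_card fun xy hxy => by
        rw [mem_filter] at hxy ⊢
        exact ⟨hxy.1, hxy.2.1⟩
    exact (Nat.cast_le.mpr h1).trans (hBT A A L d ab.1 ab.2 hd hcop hL)
  refine (sum_le_sum hgood).trans ?_
  rw [sum_const, nsmul_eq_mul, cubicClassCount]

/-- **Brun–Titchmarsh for the class sums of the Heath-Brown weight** (absolute `C, L₀`, uniform in
`c, N`, the modulus `d ≥ 1` and the class `r` coprime to `d`): with `L = hbSide c N = ⌊X(1+η)⌋ − ⌊X⌋`,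
whenever `L/d ≥ L₀`,
`∑_{k ≤ N, k ≡ r (mod d)} f₃(k) ≤ C · N^{1/3} log N · ν_d(r) · cw(d) · (L/d)² / log(L/d)`.
[cite: HeathBrownMoroz2004, §3 (3.1)–(3.3)] -/
theorem sum_hbWeight_modEq_le :
    ∃ C L₀ : ℝ, 0 < C ∧ ∀ (c : ℝ) (N d r : ℕ), 0 < d → Nat.Coprime r d →
      L₀ ≤ (hbSide c N : ℝ) / d →
      ∑ k ∈ (Icc 1 N).filter (fun k : ℕ => k ≡ r [MOD d]), hbWeight c N k ≤
        C * ((N : ℝ) ^ ((1 : ℝ) / 3) * Real.log N) * cubicClassCount d r * coprimeClassWeight d *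
          ((hbSide c N : ℝ) / d) ^ 2 / Real.log ((hbSide c N : ℝ) / d) := by
  obtain ⟨C, L₀, hC, hbox⟩ := card_box_prime_modEq_le
  refine ⟨C, max L₀ 1, hC, fun c N d r hd hr hL => ?_⟩
  have hL₀ : L₀ ≤ (hbSide c N : ℝ) / d := (le_max_left _ _).trans hL
  have hL1 : (1 : ℝ) ≤ (hbSide c N : ℝ) / d := (le_max_right _ _).trans hL
  have hdR : (1 : ℝ) ≤ d := by exact_mod_cast hd
  have hside1 : 1 ≤ hbSide c N := by
    have h : (1 : ℝ) * d ≤ hbSide c N := by rwa [le_div_iff₀ (by positivity)] at hL1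
    have : (1 : ℝ) ≤ hbSide c N := by linarith
    exact_mod_cast this
  have hN0 : 0 ≤ (N : ℝ) ^ ((1 : ℝ) / 3) * Real.log N :=
    mul_nonneg (by positivity) (Real.log_natCast_nonneg N)
  -- Step 1: class sum ≤ N^{1/3} log N · #{prime pairs with value ≡ r}
  refine (sum_hbWeight_modEq_le_card c N d r).trans ?_
  -- Step 2: prime pairs ⊆ the integer box `(⌊X⌋, ⌊X⌋ + L]²`
  have hsub := primePairs_subset_box c N hside1
  have hcount : #{xy ∈ primePairs (hbX N) (hbEta c N) | xy.1 ^ 3 + 2 * xy.2 ^ 3 ≡ r [MOD d]} ≤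
      #{xy ∈ Ioc ⌊hbX N⌋₊ (⌊hbX N⌋₊ + hbSide c N) ×ˢ Ioc ⌊hbX N⌋₊ (⌊hbX N⌋₊ + hbSide c N) |
        (xy.1 ^ 3 + 2 * xy.2 ^ 3).Prime ∧ xy.1 ^ 3 + 2 * xy.2 ^ 3 ≡ r [MOD d]} := by
    refine card_le_card fun xy hxy => ?_
    rw [mem_filter] at hxy ⊢
    obtain ⟨x, y⟩ := xy
    exact ⟨hsub hxy.1, (mem_primePairs_iff.mp hxy.1).2.2.2.2.2, hxy.2⟩
  -- Step 3: the box count over the classes of pairs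
  have hfin := (Nat.cast_le (α := ℝ).mpr hcount).trans (hbox ⌊hbX N⌋₊ (hbSide c N) d r hd hr hL₀)
  calc (N : ℝ) ^ ((1 : ℝ) / 3) * Real.log N *
        (#{xy ∈ primePairs (hbX N) (hbEta c N) | xy.1 ^ 3 + 2 * xy.2 ^ 3 ≡ r [MOD d]} : ℝ)
      ≤ (N : ℝ) ^ ((1 : ℝ) / 3) * Real.log N * (cubicClassCount d r *
          (C * coprimeClassWeight d * ((hbSide c N : ℝ) / d) ^ 2 / Real.log ((hbSide c N : ℝ) / d))) :=
        mul_le_mul_of_nonneg_left hfin hN0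
    _ = _ := by ring

/-- **Classes not coprime to the modulus carry no weight**: for `0 < d ≤ N/6` and `(r, d) ≠ 1`,
`∑_{k ≤ N, k ≡ r (mod d)} f₃(k) = 0` — a value `x³ + 2y³ > X³ = N/6 ≥ d` of a Heath-Brown pair is a
prime, so it can have no prime factor `p ∣ (r, d)`, `p ≤ d`. [cite: HeathBrownActa2001, §2 (2.2)] -/
theorem sum_hbWeight_modEq_eq_zero_of_not_coprime (c : ℝ) {N d r : ℕ} (hd : 0 < d)
    (hr : ¬ Nat.Coprime r d) (hdN : (d : ℝ) ≤ (N : ℝ) / 6) :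
    ∑ k ∈ (Icc 1 N).filter (fun k : ℕ => k ≡ r [MOD d]), hbWeight c N k = 0 := by
  refine sum_eq_zero fun k hk => ?_
  rw [mem_filter, mem_Icc] at hk
  suffices h : hbRep c N k = 0 by
    unfold hbWeight
    rw [h, Nat.cast_zero, mul_zero]
  rw [hbRep, card_eq_zero, filter_eq_empty_iff]
  rintro ⟨x, y⟩ hxy hv
  obtain ⟨hx1, -, -, -, -, hprime⟩ := mem_primePairs_iff.mp hxy
  obtain ⟨p, hp, hpr, hpd⟩ := Nat.Prime.not_coprime_iff_dvd.mp hr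
  have hpk : p ∣ k := ((hk.2.of_dvd hpd).dvd_iff dvd_rfl).mpr hpr
  have hkprime : k.Prime := hv ▸ hprime
  have hpk' : p = k := (Nat.prime_dvd_prime_iff_eq hp hkprime).mp hpk
  have hple : p ≤ d := Nat.le_of_dvd hd hpd
  have hX := hbX_nonneg' N
  have hx3 : hbX N ^ 3 < (x : ℝ) ^ 3 := by gcongr
  rw [hbX_pow_three'] at hx3
  have hkeq : (k : ℝ) = (x : ℝ) ^ 3 + 2 * (y : ℝ) ^ 3 := by
    rw [← hv]; push_cast; ring
  have hy0 : (0 : ℝ) ≤ (y : ℝ) ^ 3 := by positivity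
  have hkle : (k : ℝ) ≤ d := by exact_mod_cast hpk' ▸ hple
  linarith

end Literature.NumberTheory.Sieve.CubicMinorant

end
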